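import Literature.NumberTheory.EllipticCurves.IwasawaAlgebraRankOneIdealProofs
import Literature.NumberTheory.EllipticCurves.IwasawaAlgebraStructureProofs
import Mathlib.Data.Fintype.Pigeonhole
import HarnessLib

/-!
# A `p`-saturated rank-one submodule of a FREE `Λ`-module is free of rank one
# (the freeness of the `Λ`-adic Selmer module `𝔖 ≤ H¹(K_Σ/K, 𝐓)` without Howard's machine, modulo its rank)

Support algebra for crux stmt-BirchSwinnertonDyer-24737 `UniversalToricDescent.TwinAlgMuZeroAtThree`, line `beta-road` v10
(K2 stub `stub_howardOutputsOfFamily`, conjunct (H-i)/(H-i′) «`𝔖 ≅ Λ`»; LEAD bsd-wall-utd-p1 g24, memo `K2-JOIN-MAP-utdp1g24.md`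
§3(a)). Howard's Thm. B / Thm. 2.2.10 (and Burungale–Castella–Kim, Castella–Grossi–Lee–Skinner) state that the `Λ`-adic Selmer
module `𝔖` is TORSION-FREE OF RANK ONE; the line consumes `𝔖 ≅ Λ` (FREE). The missing step is elementary: `𝔖` sits
`p`-SATURATED (`p•h ∈ 𝔖 ⟹ h ∈ 𝔖`, because the local quotients `H¹(K_w, T)/(E(K_w) ⊗ ℤ_p) ↪ T_pH¹(K_w, E)` are
torsion-free) inside `H = H¹(K_Σ/K, 𝐓)`, which is `Λ`-free when `E(K)[p] = 0` (`IwasawaAlgebra.free_of_coinvariants'`), and: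

* §1 `exists_X_pow_mem_of_finite_quotient` — an ideal `𝔟 ≤ Λ` of finite index contains a power of `T` (pigeonhole on
  `m ↦ T^m mod 𝔟`, `T^m − T^{m'} = T^m(1 − T^{m'−m})` with a unit factor); `exists_C_p_pow_mem_of_finite_quotient` (re-spelling
  of `IwasawaAlgebra.exists_natCast_pow_mem_of_finite_quotient`).
* §2 `exists_eq_C_p_smul_of_X_smul_eq` — in a FREE `Λ`-module, `T•u = p•v ⟹ u ∈ p•H` (coefficientwise on coordinates), and its
  iterate `exists_eq_C_p_pow_smul_of_X_pow_smul_eq` (`T^n•u = p^N•v ⟹ u ∈ p^N•H`).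
* §3 **`nonempty_linearEquiv_of_saturated`** — `H` free over `Λ`, `S ≤ H` finitely generated of rank one and `p`-saturated
  ⟹ `S ≃ₗ[Λ] Λ`: `S ≅ 𝔟` of finite index (`IwasawaAlgebra.exists_linearEquiv_ideal_finite_quotient`), `p^N, T^n ∈ 𝔟`; the
  images `s₁ ↔ T^n`, `s₂ ↔ p^N` satisfy `T^n•s₂ = p^N•s₁` in `H`, so `s₂ = p^N•h₀` (§2), `h₀ ∈ S` (saturation), and `e h₀ = 1 ∈ 𝔟`.

THEOREMS ONLY; no `sorry`, no definition, no named fact; imports no `Theses` module. Nothing about Selmer groups is asserted;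
BSD is not proved by any of this. References: B. Howard, Compositio Math. 140 (2004), Lemma 2.2.9, Thm. 2.2.10; N. Bourbaki,
AC VII §4 no. 2 (reflexive hull); K. Kato, Astérisque 295 (2004), 13.8 (freeness of `𝐇¹`); L. Washington, GTM 83, §13.2.
-/

set_option linter.dupNamespace false
set_option autoImplicit false

noncomputable section

open scoped Classical

namespace Summit.BirchSwinnertonDyer.BirchSwinnertonDyer.Theorems.UniversalToricDescentFreeOfSaturated

open Literature.NumberTheory.EllipticCurves

variable {p : ℕ} [hp : Fact p.Prime]

/-! ## §1 Ideals of finite index contain powers of `T` and of `p` -/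

/-- An ideal of `Λ` of finite index contains some power of `T`: two of the classes `T^m mod 𝔟` coincide, and
`T^m − T^{m+k} = T^m (1 − T^k)` with `1 − T^k` a unit (`k ≥ 1`). [cite: Washington1997, §13.2 (𝔪^r ⊂ 𝔟 for 𝔟 of finite index)] -/
theorem exists_X_pow_mem_of_finite_quotient (𝔟 : Ideal (IwasawaAlgebra p)) [Finite (IwasawaAlgebra p ⧸ 𝔟)] :
    ∃ n : ℕ, (PowerSeries.X : IwasawaAlgebra p) ^ n ∈ 𝔟 := by
  obtain ⟨a, b, hab, heq⟩ := Finite.exists_ne_map_eq_of_infinite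
    (fun m : ℕ => Ideal.Quotient.mk 𝔟 ((PowerSeries.X : IwasawaAlgebra p) ^ m))
  -- arrange `a < b`
  wlog hlt : a < b generalizing a b
  · exact this b a hab.symm heq.symm (lt_of_le_of_ne (not_lt.mp hlt) hab.symm)
  refine ⟨a, ?_⟩
  have hmem : (PowerSeries.X : IwasawaAlgebra p) ^ a - PowerSeries.X ^ b ∈ 𝔟 := by
    rw [← Ideal.Quotient.eq]; exact heq
  have hfac : (PowerSeries.X : IwasawaAlgebra p) ^ a - PowerSeries.X ^ b =
      PowerSeries.X ^ a * (1 - PowerSeries.X ^ (b - a)) := by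
    rw [mul_sub, mul_one, ← pow_add, Nat.add_sub_cancel' hlt.le]
  have hu : IsUnit (1 - (PowerSeries.X : IwasawaAlgebra p) ^ (b - a)) := by
    rw [PowerSeries.isUnit_iff_constantCoeff, map_sub, map_one, map_pow, PowerSeries.constantCoeff_X,
      zero_pow (by omega), sub_zero]
    exact isUnit_one
  rw [hfac] at hmem
  exact (Ideal.mul_unit_mem_iff_mem 𝔟 hu).mp hmem

/-- An ideal of `Λ` of finite index contains some power of `p` (spelled `C p`).
[cite: NeukirchSchmidtWingberg2008, Ch. V §1 (5.1.4) Remark 4] -/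
theorem exists_C_p_pow_mem_of_finite_quotient (𝔟 : Ideal (IwasawaAlgebra p)) [Finite (IwasawaAlgebra p ⧸ 𝔟)] :
    ∃ N : ℕ, (PowerSeries.C (p : ℤ_[p]) : IwasawaAlgebra p) ^ N ∈ 𝔟 := by
  obtain ⟨N, hN⟩ := IwasawaAlgebra.exists_natCast_pow_mem_of_finite_quotient (p := p) 𝔟
  refine ⟨N, ?_⟩
  rwa [← map_natCast (PowerSeries.C (R := ℤ_[p])) p] at hN

/-! ## §2 In a free `Λ`-module, `T^n • u ∈ p^N • H` forces `u ∈ p^N • H` -/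

section Free

variable {H : Type*} [AddCommGroup H] [Module (IwasawaAlgebra p) H]

/-- In `Λ` itself: `T·a = p·b ⟹ a = p·a'` (compare coefficients: `a_j = p·b_{j+1}`). [cite: Washington1997, §7.1] -/
theorem exists_eq_C_p_mul_of_X_mul_eq {a b : IwasawaAlgebra p}
    (h : (PowerSeries.X : IwasawaAlgebra p) * a = PowerSeries.C (p : ℤ_[p]) * b) :
    ∃ a' : IwasawaAlgebra p, a = PowerSeries.C (p : ℤ_[p]) * a' := by
  refine ⟨PowerSeries.mk fun j => PowerSeries.coeff (j + 1) b, ?_⟩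
  ext j
  have hj := congrArg (PowerSeries.coeff (j + 1)) h
  rw [PowerSeries.coeff_succ_X_mul, PowerSeries.coeff_C_mul] at hj
  rw [hj, PowerSeries.coeff_C_mul, PowerSeries.coeff_mk]

/-- **In a FREE `Λ`-module, `T•u = p•v ⟹ u ∈ p•H`** (coordinates with respect to a basis, then `exists_eq_C_p_mul_of_X_mul_eq`).
[cite: BourbakiAC5to7, Ch. II §3 no. 2 Prop. 5] -/
theorem exists_eq_C_p_smul_of_X_smul_eq [Module.Free (IwasawaAlgebra p) H] {u v : H}
    (h : (PowerSeries.X : IwasawaAlgebra p) • u = (PowerSeries.C (p : ℤ_[p]) : IwasawaAlgebra p) • v) :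
    ∃ w : H, u = (PowerSeries.C (p : ℤ_[p]) : IwasawaAlgebra p) • w := by
  set B := Module.Free.chooseBasis (IwasawaAlgebra p) H with hB
  -- coordinates
  have hcoord : ∀ i, (PowerSeries.X : IwasawaAlgebra p) * B.repr u i = PowerSeries.C (p : ℤ_[p]) * B.repr v i := by
    intro i
    have := congrArg (fun x => B.repr x i) h
    simpa only [map_smul, Finsupp.smul_apply, smul_eq_mul] using this
  choose a' ha' using fun i => exists_eq_C_p_mul_of_X_mul_eq (hcoord i)
  -- the coordinate family `a'` is finitely supported (inside the support of `repr u`)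
  let w' : Module.Free.ChooseBasisIndex (IwasawaAlgebra p) H →₀ IwasawaAlgebra p :=
    Finsupp.onFinset (B.repr u).support (fun i => a' i) (by
      intro i hi
      rw [Finsupp.mem_support_iff]
      intro h0
      apply hi
      have := ha' i
      rw [h0, mul_comm] at this
      -- `a' i * C p = 0` with `C p ≠ 0`
      rcases mul_eq_zero.mp this.symm with h1 | h1
      · exact h1
      · exact absurd h1 (IwasawaAlgebra.C_natCast_p_ne_zero p))
  refine ⟨B.repr.symm w', ?_⟩
  apply B.repr.injective
  rw [map_smul, LinearEquiv.apply_symm_apply]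
  ext i
  rw [Finsupp.smul_apply, Finsupp.onFinset_apply, smul_eq_mul, ha' i]

/-- Iterate: **`T^n•u = p^N•v ⟹ u ∈ p^N•H`** in a free `Λ`-module. [cite: BourbakiAC5to7, Ch. II §3 no. 2 Prop. 5] -/
theorem exists_eq_C_p_pow_smul_of_X_pow_smul_eq [Module.Free (IwasawaAlgebra p) H] (n N : ℕ) {u v : H}
    (h : (PowerSeries.X : IwasawaAlgebra p) ^ n • u = (PowerSeries.C (p : ℤ_[p]) : IwasawaAlgebra p) ^ N • v) :
    ∃ w : H, u = (PowerSeries.C (p : ℤ_[p]) : IwasawaAlgebra p) ^ N • w := by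
  have hCp : (PowerSeries.C (p : ℤ_[p]) : IwasawaAlgebra p) ≠ 0 := (IwasawaAlgebra.C_natCast_p_ne_zero p)
  -- first: `T^n • u ∈ p • H` whenever `N ≥ 1`, by induction on `n`; then induct on `N`
  induction N generalizing u v with
  | zero => exact ⟨u, by rw [pow_zero, one_smul]⟩
  | succ N ih =>
    -- step 1: `u = p • u₁` (induction on `n`)
    have step : ∀ (k : ℕ) (x y : H), (PowerSeries.X : IwasawaAlgebra p) ^ k • x =
        (PowerSeries.C (p : ℤ_[p]) : IwasawaAlgebra p) • y →
        ∃ z : H, x = (PowerSeries.C (p : ℤ_[p]) : IwasawaAlgebra p) • z := by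
      intro k
      induction k with
      | zero =>
        intro x y hxy
        exact ⟨y, by rwa [pow_zero, one_smul] at hxy⟩
      | succ k ihk =>
        intro x y hxy
        rw [pow_succ', mul_smul] at hxy
        obtain ⟨z, hz⟩ := exists_eq_C_p_smul_of_X_smul_eq hxy
        -- `T^k • x = p • z`
        exact ihk x z hz
    have h1 : (PowerSeries.X : IwasawaAlgebra p) ^ n • u =
        (PowerSeries.C (p : ℤ_[p]) : IwasawaAlgebra p) • ((PowerSeries.C (p : ℤ_[p]) : IwasawaAlgebra p) ^ N • v) := by
      rw [h, pow_succ', mul_smul]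
    obtain ⟨u₁, hu₁⟩ := step n u _ h1
    -- step 2: cancel `p` and recurse: `T^n • u₁ = p^N • v`
    have h2 : (PowerSeries.X : IwasawaAlgebra p) ^ n • u₁ = (PowerSeries.C (p : ℤ_[p]) : IwasawaAlgebra p) ^ N • v := by
      have h3 : (PowerSeries.C (p : ℤ_[p]) : IwasawaAlgebra p) • ((PowerSeries.X : IwasawaAlgebra p) ^ n • u₁) =
          (PowerSeries.C (p : ℤ_[p]) : IwasawaAlgebra p) • ((PowerSeries.C (p : ℤ_[p]) : IwasawaAlgebra p) ^ N • v) := by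
        rw [smul_comm, ← hu₁, h1]
      exact (IsRegular.of_ne_zero hCp).smul_right_injective H h3
    obtain ⟨w, hw⟩ := ih h2
    exact ⟨w, by rw [hu₁, hw, ← mul_smul, ← pow_succ']⟩

end Free

/-! ## §3 Freeness of a saturated rank-one submodule -/

section Saturated

variable {H : Type*} [AddCommGroup H] [Module (IwasawaAlgebra p) H]

/-- Saturation iterates: `p^N • h ∈ S ⟹ h ∈ S`. [folklore] -/
theorem mem_of_C_p_pow_smul_mem (S : Submodule (IwasawaAlgebra p) H)
    (hsat : ∀ h : H, (PowerSeries.C (p : ℤ_[p]) : IwasawaAlgebra p) • h ∈ S → h ∈ S) (N : ℕ) {h : H}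
    (hN : (PowerSeries.C (p : ℤ_[p]) : IwasawaAlgebra p) ^ N • h ∈ S) : h ∈ S := by
  induction N generalizing h with
  | zero => rwa [pow_zero, one_smul] at hN
  | succ N ih =>
    rw [pow_succ, mul_smul] at hN
    exact hsat h (ih hN)

/-- **A `p`-saturated, finitely generated, rank-one submodule `S` of a FREE `Λ`-module is free of rank one** (`S ≃ₗ[Λ] Λ`).
With `H = H¹(K_Σ/K, 𝐓)` (free when `E(K)[p] = 0`) and `S = 𝔖` the `Λ`-adic Selmer module (saturated; rank one by Howard's
Thm. 2.2.10 (a)) this upgrades «torsion-free of rank one» to «free of rank one», the shape consumed by the line `beta-road`.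
[cite: Howard2004HeegnerKolyvagin, Lemma 2.2.9 and Thm. 2.2.10 (a)] [cite: BourbakiAC5to7, Ch. VII §4 no. 2] [cite: Kato2004Asterisque, 13.8 (p. 228)] -/
theorem nonempty_linearEquiv_of_saturated [Module.Free (IwasawaAlgebra p) H] (S : Submodule (IwasawaAlgebra p) H)
    [Module.Finite (IwasawaAlgebra p) S] (hrank : Module.rank (IwasawaAlgebra p) S = 1)
    (hsat : ∀ h : H, (PowerSeries.C (p : ℤ_[p]) : IwasawaAlgebra p) • h ∈ S → h ∈ S) :
    Nonempty (S ≃ₗ[IwasawaAlgebra p] IwasawaAlgebra p) := by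
  have hCp : (PowerSeries.C (p : ℤ_[p]) : IwasawaAlgebra p) ≠ 0 := (IwasawaAlgebra.C_natCast_p_ne_zero p)
  obtain ⟨𝔟, hfin, -, ⟨e⟩⟩ := IwasawaAlgebra.exists_linearEquiv_ideal_finite_quotient (p := p) (M := S) hrank
  haveI := hfin
  obtain ⟨N, hpN⟩ := exists_C_p_pow_mem_of_finite_quotient (p := p) 𝔟
  obtain ⟨n, hXn⟩ := exists_X_pow_mem_of_finite_quotient (p := p) 𝔟
  -- the two elements of `S` over `T^n` and `p^N`
  set s₁ : S := e.symm ⟨_, hXn⟩ with hs₁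
  set s₂ : S := e.symm ⟨_, hpN⟩ with hs₂
  have hrel : (PowerSeries.X : IwasawaAlgebra p) ^ n • (s₂ : H) =
      (PowerSeries.C (p : ℤ_[p]) : IwasawaAlgebra p) ^ N • (s₁ : H) := by
    rw [← Submodule.coe_smul, ← Submodule.coe_smul, hs₁, hs₂, ← map_smul, ← map_smul]
    congr 2
    apply Subtype.ext
    change (PowerSeries.X : IwasawaAlgebra p) ^ n * (PowerSeries.C (p : ℤ_[p])) ^ N =
      (PowerSeries.C (p : ℤ_[p]) : IwasawaAlgebra p) ^ N * PowerSeries.X ^ n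
    ring
  -- `s₂ = p^N • h₀` in the free module `H`, and `h₀ ∈ S` by saturation
  obtain ⟨h₀, hh₀⟩ := exists_eq_C_p_pow_smul_of_X_pow_smul_eq n N hrel
  have hh₀S : h₀ ∈ S := mem_of_C_p_pow_smul_mem S hsat N (by rw [← hh₀]; exact s₂.2)
  -- read in `𝔟`: `p^N * e h₀ = p^N`, so `e h₀ = 1 ∈ 𝔟`
  have hone : (1 : IwasawaAlgebra p) ∈ 𝔟 := by
    have h1 : (PowerSeries.C (p : ℤ_[p]) : IwasawaAlgebra p) ^ N • (⟨h₀, hh₀S⟩ : S) = s₂ := by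
      apply Subtype.ext
      rw [Submodule.coe_smul, hh₀]
    have h2 : (PowerSeries.C (p : ℤ_[p]) : IwasawaAlgebra p) ^ N • e ⟨h₀, hh₀S⟩ = ⟨_, hpN⟩ := by
      rw [← map_smul, h1, hs₂, LinearEquiv.apply_symm_apply]
    have h3 : (PowerSeries.C (p : ℤ_[p]) : IwasawaAlgebra p) ^ N * (e ⟨h₀, hh₀S⟩ : IwasawaAlgebra p) =
        (PowerSeries.C (p : ℤ_[p]) : IwasawaAlgebra p) ^ N * 1 := by
      rw [mul_one]
      exact congrArg Subtype.val h2
    have h4 : (e ⟨h₀, hh₀S⟩ : IwasawaAlgebra p) = 1 := mul_left_cancel₀ (pow_ne_zero N hCp) h3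
    rw [← h4]
    exact (e ⟨h₀, hh₀S⟩).2
  have htop : 𝔟 = ⊤ := (Ideal.eq_top_iff_one 𝔟).mpr hone
  exact ⟨e.trans ((LinearEquiv.ofEq _ _ htop).trans Submodule.topEquiv)⟩

/-- Variant with the rank hypothesis as `finrank = 1`. [cite: Howard2004HeegnerKolyvagin, Thm. 2.2.10 (a)] -/
theorem nonempty_linearEquiv_of_saturated_of_finrank [Module.Free (IwasawaAlgebra p) H]
    (S : Submodule (IwasawaAlgebra p) H) [Module.Finite (IwasawaAlgebra p) S]
    (hrank : Module.finrank (IwasawaAlgebra p) S = 1)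
    (hsat : ∀ h : H, (PowerSeries.C (p : ℤ_[p]) : IwasawaAlgebra p) • h ∈ S → h ∈ S) :
    Nonempty (S ≃ₗ[IwasawaAlgebra p] IwasawaAlgebra p) :=
  nonempty_linearEquiv_of_saturated S (by
    rw [← Module.finrank_eq_rank, hrank, Nat.cast_one]) hsat

end Saturated

end Summit.BirchSwinnertonDyer.BirchSwinnertonDyer.Theorems.UniversalToricDescentFreeOfSaturated

end
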